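import Summits.HubbardSuperconductivity.HubbardSuperconductivity.Theorems.AnisotropyChordDoobJohnsonChordPerronFamily
import Literature.MathematicalPhysics.QuantumLattice.ProductOperators

/-!
# Route `AnisotropyChord`, crux `ChordXY` (stmt-HubbardSuperconductivity-8146), line `doob-johnson-chord`:
# the registered stub `stub_logSlopeBound` HOLDS NEAR THE ANTIFERROMAGNETIC END `u = -1`
# (lead-8146-chordxy g1)

Vocabulary of `…Theorems.AnisotropyChordDoobJohnsonChordDefs`.  Results (even `M`):

* `otot_apply_self_re_pos` — every half-filled configuration `σ` has `Re O_{σσ} ≥ 1 > 0`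
  (`O = S⁺_tot S⁻_tot`; the site-diagonal term `S⁺_x S⁻_x` at an up spin contributes `1`, all other terms
  are `≥ 0`);
* `lam_ofReal_pos` / `lam_pos_of_isGS` — **the condensate of every normalised sector ground state is
  STRICTLY positive at EVERY real anisotropy** (Perron positivity of the ground state in the `S^z` basis
  + `Re O_{σσ} > 0`; in particular at `u = -1`, where the ground state is the sublattice-rotated Heisenberg
  singlet);
* `logSlopeBound_near_AF` — **for every even `M` and every `C^∞` family `Ψ` of real normalised sector
  ground states there is `ε > 0` with the STRICT log-slope bound `(1+u) · d/du Λ(Ψ u) < Λ(Ψ u)` for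
  `u ∈ (-1, -1+ε)`**: `u ↦ (1+u)Λ' - Λ` is continuous (`Λ ∘ Ψ` is `C^∞`, `contDiff_lam_family`) and equals
  `-Λ(Ψ(-1)) < 0` at `u = -1`;
* `stub_logSlopeBound_near_AF` — the same in the binders of the registered stub `stub_logSlopeBound`
  (reshaped skeleton `Cruxes/ChordXY/Lines/doob_johnson_chord.lean`, lead g1): the stub's inequality holds
  on `(-1, -1+ε_M)`; the open content is the window `[-1+ε_M, 0)` (numerically the binding end is `u → 0⁻`,
  K1/K2 instrument records).

Folklore + bookkeeping; no definition; sorry-free.  HONEST: a neighbourhood of the AF point only, with an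
`M`-dependent, non-explicit `ε`; nothing here proves `stub_logSlopeBound`, `stub_frozenFieldChord` or
`ChordXY`; superconductivity in the Hubbard model is not advanced.
-/

set_option linter.dupNamespace false

noncomputable section

namespace Summit.HubbardSuperconductivity.HubbardSuperconductivity.Theorems.AnisotropyChord.DoobJohnsonChord

open Matrix Finset Filter Topology
open scoped ContDiff ComplexOrder
open Literature.MathematicalPhysics.QuantumLattice Literature.Probability.LatticeModels
open Summit.HubbardSuperconductivity.HubbardSuperconductivity.Theorems.AnisotropyChord
  (condensate_apply_nonneg onSite_apply_nonneg spinRaise_apply_nonneg spinLower_apply_nonneg)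

variable (M : ℕ) [NeZero M]

/-! ### `Re O_{σσ} > 0` on the half-filled configurations -/

/-- A half-filled configuration of the `M × M` torus (`M ≠ 0`) has an up spin (`σ x = 0`). [bookkeeping] -/
theorem exists_up_of_halfFilled (σ : Config M) (hσ : (∑ z, (σ z : ℕ)) = M ^ 2 / 2) :
    ∃ x : TorusSite 2 M, σ x = 0 := by
  by_contra h
  push Not at h
  have hall : ∀ z : TorusSite 2 M, (σ z : ℕ) = 1 := by
    intro z
    have hz := h z
    have : (σ z).val < 2 := (σ z).isLt
    have hne : (σ z).val ≠ 0 := fun h0 => hz (Fin.ext h0)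
    omega
  have hsum : (∑ z : TorusSite 2 M, (σ z : ℕ)) = M ^ 2 := by
    rw [Finset.sum_congr rfl fun z _ => hall z, Finset.sum_const, smul_eq_mul, mul_one,
      Finset.card_univ]
    simp [Fintype.card_pi, ZMod.card]
  rw [hsum] at hσ
  have hM : 0 < M := Nat.pos_of_ne_zero (NeZero.ne M)
  have hM2 : 0 < M ^ 2 := by positivity
  omega

/-- Each term `(S⁺_x S⁻_y)_{σσ}` of `O_{σσ}` is `≥ 0`. [folklore] -/
theorem raise_lower_apply_self_nonneg (x y : TorusSite 2 M) (σ : Config M) :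
    0 ≤ (onSite x (spinRaise 1) * onSite y (spinLower 1)) σ σ := by
  rw [Matrix.mul_apply]
  exact Finset.sum_nonneg fun ρ _ =>
    mul_nonneg (onSite_apply_nonneg x _ (spinRaise_apply_nonneg 1) σ ρ)
      (onSite_apply_nonneg y _ (spinLower_apply_nonneg 1) ρ σ)

/-- The site-diagonal term at an up spin: `(S⁺_x S⁻_x)_{σσ} = 1` when `σ x = 0`. [folklore] -/
theorem raise_lower_apply_self_of_up (x : TorusSite 2 M) (σ : Config M) (hx : σ x = 0) :
    (onSite x (spinRaise 1) * onSite x (spinLower 1)) σ σ = 1 := by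
  rw [onSite_mul, onSite_apply, if_pos (fun y _ => rfl), spinRaise_mul_spinLower_apply, if_pos rfl, hx]
  norm_num

/-- **`Re O_{σσ} ≥ 1` on every half-filled configuration** (`O = S⁺_tot S⁻_tot`). [folklore] -/
theorem otot_apply_self_re_pos (σ : Config M) (hσ : (∑ z, (σ z : ℕ)) = M ^ 2 / 2) :
    1 ≤ (Otot M σ σ).re := by
  obtain ⟨x₀, hx₀⟩ := exists_up_of_halfFilled M σ hσ
  have hexp : Otot M σ σ = ∑ x : TorusSite 2 M, ∑ y : TorusSite 2 M,
      (onSite x (spinRaise 1) * onSite y (spinLower 1)) σ σ := by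
    unfold Otot
    rw [Finset.sum_mul_sum, Matrix.sum_apply]
    refine Finset.sum_congr rfl fun x _ => ?_
    rw [Matrix.sum_apply]
  rw [hexp, Complex.re_sum]
  -- single out the `(x₀, x₀)` term
  have hle : ((onSite x₀ (spinRaise 1) * onSite x₀ (spinLower 1)) σ σ).re ≤
      (∑ y : TorusSite 2 M, (onSite x₀ (spinRaise 1) * onSite y (spinLower 1)) σ σ).re := by
    rw [Complex.re_sum]
    refine Finset.single_le_sum (f := fun y => ((onSite x₀ (spinRaise 1) * onSite y (spinLower 1)) σ σ).re)
      (fun y _ => (Complex.le_def.1 (raise_lower_apply_self_nonneg M x₀ y σ)).1) (Finset.mem_univ x₀)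
  have hle2 : (∑ y : TorusSite 2 M, (onSite x₀ (spinRaise 1) * onSite y (spinLower 1)) σ σ).re ≤
      ∑ x : TorusSite 2 M, (∑ y : TorusSite 2 M, (onSite x (spinRaise 1) * onSite y (spinLower 1)) σ σ).re := by
    refine Finset.single_le_sum
      (f := fun x => (∑ y : TorusSite 2 M, (onSite x (spinRaise 1) * onSite y (spinLower 1)) σ σ).re)
      (fun x _ => ?_) (Finset.mem_univ x₀)
    rw [Complex.re_sum]
    exact Finset.sum_nonneg fun y _ => (Complex.le_def.1 (raise_lower_apply_self_nonneg M x y σ)).1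
  have h1 : ((onSite x₀ (spinRaise 1) * onSite x₀ (spinLower 1)) σ σ).re = 1 := by
    rw [raise_lower_apply_self_of_up M x₀ σ hx₀, Complex.one_re]
  linarith

/-! ### Strict positivity of the condensate -/

/-- **`Λ(ψ) > 0` for a real non-negative amplitude that is positive at some half-filled configuration**:
`Λ = Σ_{στ} ψ_σ Re O_{στ} ψ_τ ≥ ψ_{σ₀}² Re O_{σ₀σ₀} ≥ ψ_{σ₀}² > 0`. [folklore] -/
theorem lam_ofReal_pos (ψ : Config M → ℝ) (hnn : ∀ σ, 0 ≤ ψ σ) (σ₀ : Config M)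
    (hσ₀ : (∑ z, (σ₀ z : ℕ)) = M ^ 2 / 2) (hpos : 0 < ψ σ₀) : 0 < lam M (ofReal M ψ) := by
  rw [lam_ofReal_eq_dotProduct]
  have hOnn : ∀ σ τ : Config M, 0 ≤ (Otot M σ τ).re := fun σ τ =>
    (Complex.le_def.1 (condensate_apply_nonneg 1 σ τ)).1
  have hterm : ∀ σ τ : Config M, 0 ≤ ψ σ * ((Otot M σ τ).re * ψ τ) := fun σ τ =>
    mul_nonneg (hnn σ) (mul_nonneg (hOnn σ τ) (hnn τ))
  have hrow : ∀ σ : Config M, 0 ≤ ∑ τ, ψ σ * ((Otot M σ τ).re * ψ τ) := fun σ =>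
    Finset.sum_nonneg fun τ _ => hterm σ τ
  have hexp : ψ ⬝ᵥ (Matrix.of fun σ τ : Config M => (Otot M σ τ).re) *ᵥ ψ =
      ∑ σ, ∑ τ, ψ σ * ((Otot M σ τ).re * ψ τ) := by
    simp only [dotProduct, mulVec, of_apply, Finset.mul_sum]
  rw [hexp]
  have h1 : ψ σ₀ * ((Otot M σ₀ σ₀).re * ψ σ₀) ≤ ∑ τ, ψ σ₀ * ((Otot M σ₀ τ).re * ψ τ) :=
    Finset.single_le_sum (f := fun τ => ψ σ₀ * ((Otot M σ₀ τ).re * ψ τ)) (fun τ _ => hterm σ₀ τ)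
      (Finset.mem_univ σ₀)
  have h2 : ∑ τ, ψ σ₀ * ((Otot M σ₀ τ).re * ψ τ) ≤ ∑ σ, ∑ τ, ψ σ * ((Otot M σ τ).re * ψ τ) :=
    Finset.single_le_sum (f := fun σ => ∑ τ, ψ σ * ((Otot M σ τ).re * ψ τ)) (fun σ _ => hrow σ)
      (Finset.mem_univ σ₀)
  have h0 : 0 < ψ σ₀ * ((Otot M σ₀ σ₀).re * ψ σ₀) := by
    have := otot_apply_self_re_pos M σ₀ hσ₀
    have hsq : 0 < ψ σ₀ * ψ σ₀ := mul_pos hpos hpos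
    nlinarith
  linarith

/-- **The condensate of a normalised sector ground state is strictly positive at every real anisotropy**
(even `M`): `0 < Λ(φ)` (Perron positivity + `Re O_{σσ} > 0`; at `u = -1` the ground state is the
sublattice-rotated Heisenberg singlet, whose rotated condensate is the staggered transverse structure
factor).  Tasaki (2020) §2.4. [folklore] -/
theorem lam_pos_of_isGS (hM : Even M) (u : ℝ) (φ : Config M → ℂ) (hφ : IsGS M u φ) :
    0 < lam M φ := by
  obtain ⟨ψr, hnn, hGS, hsupp, huniq⟩ := sectorPerron_condensate M hM u
  obtain ⟨a, ha, rfl⟩ := huniq φ hφ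
  rw [lam_smul, ha, one_pow, one_mul]
  -- `ψr` is non-zero somewhere, hence positive at a half-filled configuration
  have hne : ∃ σ₀, ofReal M ψr σ₀ ≠ 0 := by
    by_contra h
    push Not at h
    have h0 : ofReal M ψr = 0 := funext h
    have h1 := hGS.2.1
    rw [h0, dotProduct_zero] at h1
    exact zero_ne_one h1
  obtain ⟨σ₀, hσ₀⟩ := hne
  have hpos : 0 < ψr σ₀ := hsupp (ofReal M ψr) hGS.1 σ₀ hσ₀
  have hw : (∑ z, (σ₀ z : ℕ)) = M ^ 2 / 2 := by
    by_contra hw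
    exact hσ₀ ((mem_sector_iff_weight M hM _).1 hGS.1 σ₀ hw)
  exact lam_ofReal_pos M ψr hnn σ₀ hw hpos

/-! ### The log-slope bound near `u = -1` -/

/-- **The strict log-slope bound holds near the antiferromagnetic end.**  For even `M` and every `C^∞`
family `Ψ` of real normalised sector ground states of `H_M(·)` there is `ε > 0` with
`(1+u) · d/du Λ(Ψ u) < Λ(Ψ u)` for all `u ∈ (-1, -1+ε)` (continuity of `(1+u)Λ' - Λ`, which is
`-Λ(Ψ(-1)) < 0` at `u = -1`). [folklore] -/
theorem logSlopeBound_near_AF (hM : Even M) {Ψ : ℝ → Config M → ℝ} (hΨ : ContDiff ℝ ∞ Ψ)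
    (hGS : ∀ u, IsGS M u (ofReal M (Ψ u))) :
    ∃ ε : ℝ, 0 < ε ∧ ∀ u ∈ Set.Ioo (-1:ℝ) (-1 + ε),
      (1 + u) * deriv (fun v => lam M (ofReal M (Ψ v))) u < lam M (ofReal M (Ψ u)) := by
  have hL : ContDiff ℝ ∞ (fun v => lam M (ofReal M (Ψ v))) := contDiff_lam_family M hΨ
  have hLc : Continuous (fun v => lam M (ofReal M (Ψ v))) := hL.continuous
  have hL'c : Continuous (deriv fun v => lam M (ofReal M (Ψ v))) := hL.continuous_deriv (by simp)
  have hf : Continuous fun v : ℝ =>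
      (1 + v) * deriv (fun v => lam M (ofReal M (Ψ v))) v - lam M (ofReal M (Ψ v)) :=
    ((continuous_const.add continuous_id).mul hL'c).sub hLc
  have h0 : (1 + (-1:ℝ)) * deriv (fun v => lam M (ofReal M (Ψ v))) (-1) - lam M (ofReal M (Ψ (-1))) < 0 := by
    have := lam_pos_of_isGS M hM (-1) _ (hGS (-1))
    linarith
  have hev : ∀ᶠ v in 𝓝 (-1:ℝ),
      (1 + v) * deriv (fun v => lam M (ofReal M (Ψ v))) v - lam M (ofReal M (Ψ v)) < 0 :=
    hf.continuousAt.eventually (Iio_mem_nhds h0)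
  obtain ⟨ε, hε, hball⟩ := Metric.eventually_nhds_iff.1 hev
  refine ⟨ε, hε, fun u hu => ?_⟩
  have hdist : dist u (-1) < ε := by
    rw [Real.dist_eq, abs_lt]
    constructor <;> linarith [hu.1, hu.2]
  have := hball hdist
  linarith

/-- **The registered stub `stub_logSlopeBound` holds on a neighbourhood of the AF point** — same binders
as the stub (reshaped skeleton `Cruxes/ChordXY/Lines/doob_johnson_chord.lean`, lead g1), conclusion
restricted to `u ∈ (-1, -1+ε)` for some `ε = ε(M, Ψ) > 0`.  What remains open is the window `[-1+ε, 0)`.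
[bookkeeping] -/
theorem stub_logSlopeBound_near_AF :
    ∀ (M : ℕ) [NeZero M], Even M → 4 ≤ M → ∀ Ψ : ℝ → Config M → ℝ, ContDiff ℝ ∞ Ψ →
      (∀ u, IsGS M u (ofReal M (Ψ u))) → (∀ u σ, 0 ≤ Ψ u σ) →
      ∃ ε : ℝ, 0 < ε ∧ ∀ u ∈ Set.Ioo (-1:ℝ) (-1 + ε),
        (1 + u) * deriv (fun v => lam M (ofReal M (Ψ v))) u ≤ lam M (ofReal M (Ψ u)) := by
  intro M _ hM _ Ψ hΨ hGS _
  obtain ⟨ε, hε, h⟩ := logSlopeBound_near_AF M hM hΨ hGS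
  exact ⟨ε, hε, fun u hu => (h u hu).le⟩

end Summit.HubbardSuperconductivity.HubbardSuperconductivity.Theorems.AnisotropyChord.DoobJohnsonChord

end
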